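import Mathlib.Analysis.Calculus.ParametricIntegral        -- `hasDerivAt_integral_of_dominated_loc_of_deriv_le`
import Mathlib.Analysis.Calculus.FDeriv.Extend              -- `hasDerivWithinAt_Ici_of_tendsto_deriv` (one-sided derivative at the cone)
import Literature.Geometry.ComplexHyperbolic.UnitBallSheetIntegralBounds  -- ★ part 1: majorants uniform in `ε ≥ 0`, `ρ`-calculus, support lemmas
import HarnessLib

/-!
# Differentiating the integrals over the hyperboloid sheets `Q = −ε` twice in the blow-up parameter, down to the cone `ε = 0`
# (ROAD A (A3-c) ENGINE, part 2: the `C²` statement behind the second-order expansion of the `ε²`-normalised `K`-central orbital integrals of `U(2,1)`)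

Topic `Geometry/ComplexHyperbolic`; namespace `Literature.Geometry.ComplexHyperbolic.BallModel`.  THEOREMS ONLY (no `def`, no instance, no notation,
no axiom, no named fact, no `sorry`).  Cell `pub/hodgecm-mathlib`, ENGINE T1 (crux H413 = `stmt-HodgeConjecture-24833`); floor-1½ preparation, count-neutral,
under row (S-d) ∕ «SdArch» ED. 3 node N1 = the (L_{U(2,1)}) letter ★ `ArchCentralLimitFormulaRankTwo` (`stub_ArchCentralLimitU21`): brick **ROAD A (A3-c) ENGINE**
(F0P3a-p03 (g10) census c3af6e58 §2 (A3); A-p14 (g28) cost census e5e8455f §3 + interface note (A2″) 08:26Z; LEAD F0P3a-plan (g10) WORD T9-1 (4), 2026-09-01;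
author F0P3a-p05 (g13)).  Continues ★ `UnitBallHyperboloidChart` (`β = 9·d⁴W`), ★ `UnitBallKCentralConeLimit` (`ε²·Φ(k_ε, Θ) = 9∫_{ℂ²} Θ(u•1 − η•N(W, √(ε+|W|²))) d⁴W`
and its limit at the cone).

THE MATHEMATICS (Θ-free).  After the blow-up, EVERY quantity ROAD A needs at the compact wall `k_ε = diag(u,u,u+εη)` — the normalised orbital integral
`ε²Φ(k_ε, Θ)`, its tangential derivatives, and the transversal term `ε⁴·N²Φ(k_ε)` of ★ (A2′)∕(A2″) `ArchCompactWallTransversalExpansion` (an orbital integral over the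
same orbit of `Ψ(P)`, `P = −ε⁻¹N(x(W,ε))` polynomially) — is a SHEET INTEGRAL
    `I(ε) = ∫_{ℂ²} Λ(W, √(ε + |W|²)) d⁴W`
for a datum `Λ : ℂ² × ℝ → G` that is `C²` IN THE REAL SHEET COORDINATE `r` (derivatives `Λ′ = ∂_rΛ`, `Λ″ = ∂_r²Λ`, all three jointly continuous) and has an
`r²`-SUPPORT BOUND `Λ(W, r) = 0` for `r² ≥ S` (for `Λ(W,r) = Θ(u•1 − η•N(W,r))` this is ★ `exists_radius_apply_add_eq_zero`: the `(2,2)` entry is `u + η r²`).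
Since `ρ := √(ε+|W|²) ≥ ‖W‖` and `∂_ερ = (2ρ)⁻¹`, `∂_ε²ρ = −(4ρ³)⁻¹`, the `ε`-derivatives of the integrand are
    `∂_ε [Λ(W,ρ)] = (2ρ)⁻¹•Λ′(W,ρ)`,   `∂_ε² [Λ(W,ρ)] = (4ρ²)⁻¹•Λ″(W,ρ) − (4ρ³)⁻¹•Λ′(W,ρ)`,
dominated UNIFORMLY IN `ε ≥ 0` by `(B∕2)‖W‖⁻¹·𝟙{|W|²≤S}` and `D‖W‖⁻³·𝟙{|W|²≤S}` (`Λ′ = Λ″ = 0` past the support; `ρ, ‖W‖ ≤ √S` on it), and `‖W‖⁻¹`, `‖W‖⁻³`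
are locally integrable on `ℝ⁴` (exponents `< 4 = dim_ℝ ℂ²`, Mathlib `integrableOn_ball_of_norm_le_rpow`).  Hence (Mathlib `hasDerivAt_integral_of_dominated_loc_of_deriv_le`,
`continuousOn_of_dominated`, `hasDerivWithinAt_Ici_of_tendsto_deriv`):
  **`I ∈ C²([0,∞))`: for `ε > 0`, `I′(ε) = I₁(ε) := ∫ (2ρ)⁻¹•Λ′(W,ρ) d⁴W` and `I₁′(ε) = I₂(ε) := ∫ [(4ρ²)⁻¹•Λ″ − (4ρ³)⁻¹•Λ′](W,ρ) d⁴W`; `I, I₁, I₂` are continuous on `[0,∞)`;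
  and AT THE CONE `I` has right-derivative `I₁(0) = ∫ (2|W|)⁻¹•Λ′(W,|W|) d⁴W`, `I₁` has right-derivative `I₂(0)`** — so `I(ε) = I(0) + I₁(0)ε + ½I₂(0)ε² + o(ε²)`.
This is exactly the order to which (A4) must expand (the `(N′Δ)(k_ε) ~ ε²` prefactor divides `ε²Φ`), with no ray-by-ray endpoint analysis: one global chart, one
fixed measure, two integrable singularities at `W = 0`.  (Third derivatives are NOT claimed: `∂_ε³ρ ~ ρ⁻⁵` is not integrable on `ℝ⁴` — consistent with the
`ε³ log ε` term of the expansion.)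

Part 1 (★ `UnitBallSheetIntegralBounds`) supplies the `ρ`-calculus, the support lemmas and the three integrable majorants; this part 2 has the HEADS:
* **`hasDerivAt_integral_sheet`** (`ε > 0`: integrability of the order-1 integrand + `HasDerivAt I (I₁ ε) ε`), **`hasDerivAt_integral_sheet_deriv`**
  (`HasDerivAt I₁ (I₂ ε) ε`), **`continuousOn_integral_sheet_zero∕one∕two`** (on `Ici 0`), **`hasDerivWithinAt_integral_sheet_zero`**, **`hasDerivWithinAt_integral_sheet_one`**
  (one-sided at `0`).
HONEST LABEL: HC_CM is proved only modulo the printed citations until rung 0 closes; this file is real analysis over ★ ball-model files and pays nothing by itself.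

## References
* [Rogawski1990] J. D. Rogawski, *Automorphic Representations of Unitary Groups in Three Variables*, Ann. of Math. Stud. 123 (1990), §8.4 pp. 126–127 (the singular orbital integrals
  at the compact wall of `U(2,1)`, normalised, are differentiated twice on the way to the central limit formula).
* [Varadarajan1989] V. S. Varadarajan, *An Introduction to Harmonic Analysis on Semisimple Lie Groups* (1989), §6.4 (behaviour of `F_f` and its derivatives at singular points).
* [Rudin1980] W. Rudin, *Function Theory in the Unit Ball of ℂⁿ* (1980), §1.4 (integration on `ℂⁿ`; local integrability of `|z|^{−k}`, `k < 2n`).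
-/

noncomputable section

open MeasureTheory MeasureTheory.Measure Set Filter Topology Metric
open scoped ENNReal

namespace Literature.Geometry.ComplexHyperbolic.BallModel

section Engine

variable {G : Type*} [NormedAddCommGroup G] [NormedSpace ℝ G] {Λ Λ' Λ'' : (Fin 2 → ℂ) → ℝ → G} {S : ℝ}

/-! ### The sheet integrals: derivatives under the integral sign for `ε > 0`, continuity on `[0, ∞)`, one-sided derivatives at `ε = 0` -/

omit [NormedSpace ℝ G] in
/-- The order-0 sheet integrand `W ↦ Λ(W, √(ε+|W|²))` is continuous (any `ε`). [cite: Rudin1980, §1.4] -/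
theorem continuous_sheet_zero (hΛ : Continuous (Function.uncurry Λ)) (ε : ℝ) :
    Continuous fun W : Fin 2 → ℂ => Λ W (Real.sqrt (ε + nsq W)) :=
  hΛ.comp (continuous_id.prodMk ((continuous_const.add continuous_fun_nsq).sqrt))

omit [NormedSpace ℝ G] in
/-- The data `W ↦ Λ′(W, √(ε+|W|²))` are continuous (any `ε`). [cite: Rudin1980, §1.4] -/
theorem continuous_sheet_data (hΛ' : Continuous (Function.uncurry Λ')) (ε : ℝ) :
    Continuous fun W : Fin 2 → ℂ => Λ' W (Real.sqrt (ε + nsq W)) :=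
  hΛ'.comp (continuous_id.prodMk ((continuous_const.add continuous_fun_nsq).sqrt))

/-- The order-1 sheet integrand `W ↦ (2ρ)⁻¹ • Λ′(W, ρ)` is a.e.-strongly measurable (any `ε`). [cite: Rudin1980, §1.4] -/
theorem aestronglyMeasurable_sheet_one (hΛ' : Continuous (Function.uncurry Λ')) (ε : ℝ) :
    AEStronglyMeasurable (fun W : Fin 2 → ℂ => (2 * Real.sqrt (ε + nsq W))⁻¹ • Λ' W (Real.sqrt (ε + nsq W))) volume :=
  ((continuous_const.mul ((continuous_const.add continuous_fun_nsq).sqrt)).measurable.inv.aestronglyMeasurable).smul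
    (continuous_sheet_data hΛ' ε).aestronglyMeasurable

/-- The order-2 sheet integrand is a.e.-strongly measurable (any `ε`). [cite: Rudin1980, §1.4] -/
theorem aestronglyMeasurable_sheet_two (hΛ' : Continuous (Function.uncurry Λ')) (hΛ'' : Continuous (Function.uncurry Λ'')) (ε : ℝ) :
    AEStronglyMeasurable (fun W : Fin 2 → ℂ => (4 * Real.sqrt (ε + nsq W) ^ 2)⁻¹ • Λ'' W (Real.sqrt (ε + nsq W)) -
      (4 * Real.sqrt (ε + nsq W) ^ 3)⁻¹ • Λ' W (Real.sqrt (ε + nsq W))) volume :=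
  (((continuous_const.mul (((continuous_const.add continuous_fun_nsq).sqrt).pow 2)).measurable.inv.aestronglyMeasurable).smul
    (continuous_sheet_data hΛ'' ε).aestronglyMeasurable).sub
    (((continuous_const.mul (((continuous_const.add continuous_fun_nsq).sqrt).pow 3)).measurable.inv.aestronglyMeasurable).smul
      (continuous_sheet_data hΛ' ε).aestronglyMeasurable)

/-- For `W ≠ 0` the order-1 integrand is continuous in `ε ∈ [0, ∞)`. [cite: Rudin1980, §1.4] -/
theorem continuousOn_sheet_one_param (hΛ' : Continuous (Function.uncurry Λ')) {W : Fin 2 → ℂ} (hW : W ≠ 0) :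
    ContinuousOn (fun ε : ℝ => (2 * Real.sqrt (ε + nsq W))⁻¹ • Λ' W (Real.sqrt (ε + nsq W))) (Ici 0) := by
  have hn : 0 < nsq W := nsq_pos_of_ne_zero hW
  have hρ : Continuous fun ε : ℝ => Real.sqrt (ε + nsq W) := (continuous_id.add continuous_const).sqrt
  have hne : ∀ ε ∈ Ici (0 : ℝ), Real.sqrt (ε + nsq W) ≠ 0 := fun ε hε =>
    (Real.sqrt_pos.2 (by have : (0 : ℝ) ≤ ε := hε; linarith)).ne'
  refine ContinuousOn.smul ?_ (hΛ'.comp (continuous_const.prodMk hρ)).continuousOn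
  exact ((continuous_const.mul hρ).continuousOn).inv₀ fun ε hε => mul_ne_zero two_ne_zero (hne ε hε)

/-- For `W ≠ 0` the order-2 integrand is continuous in `ε ∈ [0, ∞)`. [cite: Rudin1980, §1.4] -/
theorem continuousOn_sheet_two_param (hΛ' : Continuous (Function.uncurry Λ')) (hΛ'' : Continuous (Function.uncurry Λ'')) {W : Fin 2 → ℂ} (hW : W ≠ 0) :
    ContinuousOn (fun ε : ℝ => (4 * Real.sqrt (ε + nsq W) ^ 2)⁻¹ • Λ'' W (Real.sqrt (ε + nsq W)) -
      (4 * Real.sqrt (ε + nsq W) ^ 3)⁻¹ • Λ' W (Real.sqrt (ε + nsq W))) (Ici 0) := by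
  have hn : 0 < nsq W := nsq_pos_of_ne_zero hW
  have hρ : Continuous fun ε : ℝ => Real.sqrt (ε + nsq W) := (continuous_id.add continuous_const).sqrt
  have hne : ∀ ε ∈ Ici (0 : ℝ), Real.sqrt (ε + nsq W) ≠ 0 := fun ε hε =>
    (Real.sqrt_pos.2 (by have : (0 : ℝ) ≤ ε := hε; linarith)).ne'
  refine ContinuousOn.sub (ContinuousOn.smul ?_ (hΛ''.comp (continuous_const.prodMk hρ)).continuousOn)
    (ContinuousOn.smul ?_ (hΛ'.comp (continuous_const.prodMk hρ)).continuousOn)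
  · exact ((continuous_const.mul (hρ.pow 2)).continuousOn).inv₀ fun ε hε => mul_ne_zero (by norm_num) (pow_ne_zero 2 (hne ε hε))
  · exact ((continuous_const.mul (hρ.pow 3)).continuousOn).inv₀ fun ε hε => mul_ne_zero (by norm_num) (pow_ne_zero 3 (hne ε hε))

/-- **DIFFERENTIATION UNDER THE INTEGRAL SIGN, FIRST ORDER (`ε > 0`)**: `I′(ε) = ∫ (2ρ)⁻¹ • Λ′(W, ρ) d⁴W` and this integrand is integrable
(Mathlib `hasDerivAt_integral_of_dominated_loc_of_deriv_le` with the majorant `(B∕2)‖W‖⁻¹𝟙{nsq ≤ S}`). [cite: Rogawski1990, §8.4 pp. 126–127] [cite: Rudin1980, §1.4] -/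
theorem hasDerivAt_integral_sheet (hΛ : Continuous (Function.uncurry Λ)) (hΛ' : Continuous (Function.uncurry Λ'))
    (hd : ∀ W r, HasDerivAt (Λ W) (Λ' W r) r) (hS : ∀ W r, S ≤ r ^ 2 → Λ W r = 0) {ε : ℝ} (hε : 0 < ε) :
    Integrable (fun W : Fin 2 → ℂ => (2 * Real.sqrt (ε + nsq W))⁻¹ • Λ' W (Real.sqrt (ε + nsq W))) ∧
      HasDerivAt (fun ε : ℝ => ∫ W : Fin 2 → ℂ, Λ W (Real.sqrt (ε + nsq W)))
        (∫ W : Fin 2 → ℂ, (2 * Real.sqrt (ε + nsq W))⁻¹ • Λ' W (Real.sqrt (ε + nsq W))) ε := by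
  obtain ⟨C, -, hC⟩ := exists_bound_sheet_zero hΛ hS
  obtain ⟨B, -, hB⟩ := exists_bound_sheet_one hΛ' hd hS
  have hs : Ioi (ε / 2) ∈ 𝓝 ε := Ioi_mem_nhds (by linarith)
  refine hasDerivAt_integral_of_dominated_loc_of_deriv_le
    (F := fun (ε : ℝ) (W : Fin 2 → ℂ) => Λ W (Real.sqrt (ε + nsq W)))
    (F' := fun (ε : ℝ) (W : Fin 2 → ℂ) => (2 * Real.sqrt (ε + nsq W))⁻¹ • Λ' W (Real.sqrt (ε + nsq W)))
    hs (Filter.Eventually.of_forall fun x => (continuous_sheet_zero hΛ x).aestronglyMeasurable) ?_ (aestronglyMeasurable_sheet_one hΛ' ε) ?_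
    (integrable_indicator_nsq_le_mul_norm_rpow_neg S (B / 2) (by norm_num : (1 : ℝ) < 4)) ?_
  · exact (integrable_indicator_nsq_le_const S C).mono' (continuous_sheet_zero hΛ ε).aestronglyMeasurable
      (Filter.Eventually.of_forall fun W => hC ε hε.le W)
  · filter_upwards [ae_ne_zero_volume_fin_two_complex] with W hW x hx
    exact hB x (by have := mem_Ioi.1 hx; linarith) W hW
  · refine Filter.Eventually.of_forall fun W x hx => ?_
    have hx0 : 0 < x + nsq W := by have := mem_Ioi.1 hx; linarith [nsq_nonneg W]
    exact hasDerivAt_comp_sqrt_add_const (hd W) hx0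

/-- **DIFFERENTIATION UNDER THE INTEGRAL SIGN, SECOND ORDER (`ε > 0`)**: `I″(ε) = ∫ [(4ρ²)⁻¹ • Λ″(W,ρ) − (4ρ³)⁻¹ • Λ′(W,ρ)] d⁴W`, integrand integrable
(majorant `D‖W‖⁻³𝟙{nsq ≤ S}`, still integrable on `ℝ⁴`). [cite: Rogawski1990, §8.4 pp. 126–127] [cite: Rudin1980, §1.4] -/
theorem hasDerivAt_integral_sheet_deriv (hΛ : Continuous (Function.uncurry Λ)) (hΛ' : Continuous (Function.uncurry Λ'))
    (hΛ'' : Continuous (Function.uncurry Λ'')) (hd : ∀ W r, HasDerivAt (Λ W) (Λ' W r) r) (hd' : ∀ W r, HasDerivAt (Λ' W) (Λ'' W r) r)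
    (hS : ∀ W r, S ≤ r ^ 2 → Λ W r = 0) {ε : ℝ} (hε : 0 < ε) :
    Integrable (fun W : Fin 2 → ℂ => (4 * Real.sqrt (ε + nsq W) ^ 2)⁻¹ • Λ'' W (Real.sqrt (ε + nsq W)) -
        (4 * Real.sqrt (ε + nsq W) ^ 3)⁻¹ • Λ' W (Real.sqrt (ε + nsq W))) ∧
      HasDerivAt (fun ε : ℝ => ∫ W : Fin 2 → ℂ, (2 * Real.sqrt (ε + nsq W))⁻¹ • Λ' W (Real.sqrt (ε + nsq W)))
        (∫ W : Fin 2 → ℂ, ((4 * Real.sqrt (ε + nsq W) ^ 2)⁻¹ • Λ'' W (Real.sqrt (ε + nsq W)) -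
          (4 * Real.sqrt (ε + nsq W) ^ 3)⁻¹ • Λ' W (Real.sqrt (ε + nsq W)))) ε := by
  obtain ⟨D, -, hD⟩ := exists_bound_sheet_two hΛ' hΛ'' hd hd' hS
  have hs : Ioi (ε / 2) ∈ 𝓝 ε := Ioi_mem_nhds (by linarith)
  refine hasDerivAt_integral_of_dominated_loc_of_deriv_le
    (F := fun (ε : ℝ) (W : Fin 2 → ℂ) => (2 * Real.sqrt (ε + nsq W))⁻¹ • Λ' W (Real.sqrt (ε + nsq W)))
    (F' := fun (ε : ℝ) (W : Fin 2 → ℂ) => (4 * Real.sqrt (ε + nsq W) ^ 2)⁻¹ • Λ'' W (Real.sqrt (ε + nsq W)) -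
      (4 * Real.sqrt (ε + nsq W) ^ 3)⁻¹ • Λ' W (Real.sqrt (ε + nsq W)))
    hs (Filter.Eventually.of_forall fun x => aestronglyMeasurable_sheet_one hΛ' x) (hasDerivAt_integral_sheet hΛ hΛ' hd hS hε).1
    (aestronglyMeasurable_sheet_two hΛ' hΛ'' ε) ?_ (integrable_indicator_nsq_le_mul_norm_rpow_neg S D (by norm_num : (3 : ℝ) < 4)) ?_
  · filter_upwards [ae_ne_zero_volume_fin_two_complex] with W hW x hx
    exact hD x (by have := mem_Ioi.1 hx; linarith) W hW
  · refine Filter.Eventually.of_forall fun W x hx => ?_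
    have hx0 : 0 < x + nsq W := by have := mem_Ioi.1 hx; linarith [nsq_nonneg W]
    exact hasDerivAt_inv_smul_comp_sqrt_add_const (hd' W) hx0

/-- **CONTINUITY OF `I` ON `[0, ∞)`** (down to the cone `ε = 0`; dominated convergence). [cite: Rogawski1990, §8.4 pp. 126–127] [cite: Rudin1980, §1.4] -/
theorem continuousOn_integral_sheet_zero (hΛ : Continuous (Function.uncurry Λ)) (hS : ∀ W r, S ≤ r ^ 2 → Λ W r = 0) :
    ContinuousOn (fun ε : ℝ => ∫ W : Fin 2 → ℂ, Λ W (Real.sqrt (ε + nsq W))) (Ici 0) := by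
  obtain ⟨C, -, hC⟩ := exists_bound_sheet_zero hΛ hS
  refine continuousOn_of_dominated (fun ε _ => (continuous_sheet_zero hΛ ε).aestronglyMeasurable)
    (fun ε hε => Filter.Eventually.of_forall fun W => hC ε hε W) (integrable_indicator_nsq_le_const S C)
    (Filter.Eventually.of_forall fun W => ?_)
  exact (hΛ.comp (continuous_const.prodMk ((continuous_id.add continuous_const).sqrt))).continuousOn

/-- **CONTINUITY OF `I₁` ON `[0, ∞)`**: the first-derivative integral extends continuously to `ε = 0`, where its integrand
`(2|W|)⁻¹ • Λ′(W, |W|)` is still integrable (`‖W‖⁻¹ ∈ L¹_loc(ℝ⁴)`). [cite: Rogawski1990, §8.4 pp. 126–127] [cite: Rudin1980, §1.4] -/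
theorem continuousOn_integral_sheet_one (hΛ' : Continuous (Function.uncurry Λ')) (hd : ∀ W r, HasDerivAt (Λ W) (Λ' W r) r)
    (hS : ∀ W r, S ≤ r ^ 2 → Λ W r = 0) :
    ContinuousOn (fun ε : ℝ => ∫ W : Fin 2 → ℂ, (2 * Real.sqrt (ε + nsq W))⁻¹ • Λ' W (Real.sqrt (ε + nsq W))) (Ici 0) := by
  obtain ⟨B, -, hB⟩ := exists_bound_sheet_one hΛ' hd hS
  refine continuousOn_of_dominated (fun ε _ => aestronglyMeasurable_sheet_one hΛ' ε) (fun ε hε => ?_)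
    (integrable_indicator_nsq_le_mul_norm_rpow_neg S (B / 2) (by norm_num : (1 : ℝ) < 4)) ?_
  · filter_upwards [ae_ne_zero_volume_fin_two_complex] with W hW
    exact hB ε hε W hW
  · filter_upwards [ae_ne_zero_volume_fin_two_complex] with W hW
    exact continuousOn_sheet_one_param hΛ' hW

/-- **CONTINUITY OF `I₂` ON `[0, ∞)`**: the second-derivative integral extends continuously to `ε = 0` (`‖W‖⁻³ ∈ L¹_loc(ℝ⁴)`).
[cite: Rogawski1990, §8.4 pp. 126–127] [cite: Rudin1980, §1.4] -/
theorem continuousOn_integral_sheet_two (hΛ' : Continuous (Function.uncurry Λ')) (hΛ'' : Continuous (Function.uncurry Λ''))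
    (hd : ∀ W r, HasDerivAt (Λ W) (Λ' W r) r) (hd' : ∀ W r, HasDerivAt (Λ' W) (Λ'' W r) r) (hS : ∀ W r, S ≤ r ^ 2 → Λ W r = 0) :
    ContinuousOn (fun ε : ℝ => ∫ W : Fin 2 → ℂ, ((4 * Real.sqrt (ε + nsq W) ^ 2)⁻¹ • Λ'' W (Real.sqrt (ε + nsq W)) -
      (4 * Real.sqrt (ε + nsq W) ^ 3)⁻¹ • Λ' W (Real.sqrt (ε + nsq W)))) (Ici 0) := by
  obtain ⟨D, -, hD⟩ := exists_bound_sheet_two hΛ' hΛ'' hd hd' hS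
  refine continuousOn_of_dominated (fun ε _ => aestronglyMeasurable_sheet_two hΛ' hΛ'' ε) (fun ε hε => ?_)
    (integrable_indicator_nsq_le_mul_norm_rpow_neg S D (by norm_num : (3 : ℝ) < 4)) ?_
  · filter_upwards [ae_ne_zero_volume_fin_two_complex] with W hW
    exact hD ε hε W hW
  · filter_upwards [ae_ne_zero_volume_fin_two_complex] with W hW
    exact continuousOn_sheet_two_param hΛ' hΛ'' hW

/-- **ONE-SIDED FIRST DERIVATIVE AT THE CONE `ε = 0`**: `I` has right-derivative `I₁(0) = ∫ (2|W|)⁻¹ • Λ′(W, |W|) d⁴W` at `0` within `[0,∞)`.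
[cite: Rogawski1990, §8.4 pp. 126–127] [cite: Rudin1980, §1.4] -/
theorem hasDerivWithinAt_integral_sheet_zero (hΛ : Continuous (Function.uncurry Λ)) (hΛ' : Continuous (Function.uncurry Λ'))
    (hd : ∀ W r, HasDerivAt (Λ W) (Λ' W r) r) (hS : ∀ W r, S ≤ r ^ 2 → Λ W r = 0) :
    HasDerivWithinAt (fun ε : ℝ => ∫ W : Fin 2 → ℂ, Λ W (Real.sqrt (ε + nsq W)))
      (∫ W : Fin 2 → ℂ, (2 * Real.sqrt (nsq W))⁻¹ • Λ' W (Real.sqrt (nsq W))) (Ici 0) 0 := by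
  have hI := fun (x : ℝ) (hx : x ∈ Ioi (0 : ℝ)) => (hasDerivAt_integral_sheet hΛ hΛ' hd hS (mem_Ioi.1 hx)).2
  have h0 : (0 : ℝ) ∈ Ici (0 : ℝ) := Set.mem_Ici.2 le_rfl
  refine hasDerivWithinAt_Ici_of_tendsto_deriv (s := Ioi 0) (fun x hx => (hI x hx).differentiableAt.differentiableWithinAt)
    (((continuousOn_integral_sheet_zero hΛ hS).continuousWithinAt h0).mono Ioi_subset_Ici_self) self_mem_nhdsWithin ?_
  have h1 := ((continuousOn_integral_sheet_one hΛ' hd hS).continuousWithinAt h0).tendsto.mono_left (nhdsWithin_mono _ Ioi_subset_Ici_self)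
  simp only [zero_add] at h1
  refine h1.congr' ?_
  filter_upwards [self_mem_nhdsWithin] with x hx
  exact (hI x hx).deriv.symm

/-- **ONE-SIDED SECOND DERIVATIVE AT THE CONE `ε = 0`**: `I₁` has right-derivative `I₂(0)` at `0` within `[0,∞)`; together with the previous heads,
`I(ε) = I(0) + I₁(0)·ε + ½I₂(0)·ε² + o(ε²)` as `ε → 0⁺` for every instance of the engine. [cite: Rogawski1990, §8.4 pp. 126–127] [cite: Rudin1980, §1.4] -/
theorem hasDerivWithinAt_integral_sheet_one (hΛ : Continuous (Function.uncurry Λ)) (hΛ' : Continuous (Function.uncurry Λ'))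
    (hΛ'' : Continuous (Function.uncurry Λ'')) (hd : ∀ W r, HasDerivAt (Λ W) (Λ' W r) r) (hd' : ∀ W r, HasDerivAt (Λ' W) (Λ'' W r) r)
    (hS : ∀ W r, S ≤ r ^ 2 → Λ W r = 0) :
    HasDerivWithinAt (fun ε : ℝ => ∫ W : Fin 2 → ℂ, (2 * Real.sqrt (ε + nsq W))⁻¹ • Λ' W (Real.sqrt (ε + nsq W)))
      (∫ W : Fin 2 → ℂ, ((4 * Real.sqrt (nsq W) ^ 2)⁻¹ • Λ'' W (Real.sqrt (nsq W)) - (4 * Real.sqrt (nsq W) ^ 3)⁻¹ • Λ' W (Real.sqrt (nsq W))))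
      (Ici 0) 0 := by
  have hI := fun (x : ℝ) (hx : x ∈ Ioi (0 : ℝ)) => (hasDerivAt_integral_sheet_deriv hΛ hΛ' hΛ'' hd hd' hS (mem_Ioi.1 hx)).2
  have h0 : (0 : ℝ) ∈ Ici (0 : ℝ) := Set.mem_Ici.2 le_rfl
  refine hasDerivWithinAt_Ici_of_tendsto_deriv (s := Ioi 0) (fun x hx => (hI x hx).differentiableAt.differentiableWithinAt)
    (((continuousOn_integral_sheet_one hΛ' hd hS).continuousWithinAt h0).mono Ioi_subset_Ici_self) self_mem_nhdsWithin ?_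
  have h1 := ((continuousOn_integral_sheet_two hΛ' hΛ'' hd hd' hS).continuousWithinAt h0).tendsto.mono_left
    (nhdsWithin_mono _ Ioi_subset_Ici_self)
  simp only [zero_add] at h1
  refine h1.congr' ?_
  filter_upwards [self_mem_nhdsWithin] with x hx
  exact (hI x hx).deriv.symm

end Engine

end Literature.Geometry.ComplexHyperbolic.BallModel

end
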